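import Summits.BirchSwinnertonDyer.Rank1Residual.F1Sign2.HeegnerCuspSymbolAtTwo
import HarnessLib.Audit.Tags
import HarnessLib

/-!
# Cell `bsd-f1-sign2`, analytic lens (planner `-an` g18, MEMO-an v1.58 addendum §21): AN-35 «THE MODULAR DEGREE MOD 4 IS THE SIGNED OBJECT AT 2»
# (`ν(E) := [deg φ ≡ 2 (mod 4)]`; TURNKEY D-an-97 line `nu_one_topological` for the lead's R⁺₀; ten statement rows + three kernel compositions + REF1's J3/G1/G2)

PORT (cell `bsd-f1-sign2`, seat `-ty` g13, TURNKEY D-an-97, INBOX 2026-08-28T23:47:02Z) of -an g18's `HOME/MEMO-an-data/g18/Sketch_v52.lean` (sha16 e4ae380f4eb9d988;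
farm rc 0, 0 sorry, probes 6/6 CLEAN; crux idea `modular-degree-mod-four` 4ae50f78ee1b; ENGINE MD census 3 386 curves).  Bodies VERBATIM from the sketch, in
the sketch's order and namespace `…F1Sign2.ANg18`; the typer's only edits are this header, the imports of `HarnessLib.Audit.Tags` / `HarnessLib`, the cite
keys `Snowden2011` → `Snowden2011` and `Ogg1983` → `OggRealPoints1983` (ledger keys; `Dummigan2006` and `Snowden2011` added to the bib by
the typer), `@[conjecture]` on AN-35b♯/35c/35d/35e/35g per REF1 §150 with REF1's one-liners in every docstring, REF1's kernel riders J3/G1/G2 at the end, and (pass 2, text only) REF2 v44 §2 below.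
CONTENT.  Setting `Δ_W > 0`, `E(ℚ)[2] = 0`, datum `Dt : ModularParametrizationData W N_W` with FRICKE-PLUS newform (`IsFrickeEigen N Dt.f 1`,
`modularSymbol Dt.f 0 = 0`) and odd Manin constant.  Helper defs `twistedRealFiberOrbitCount` (`Nat.card` of a `Y0 N` subtype; finite fibres, junk-free on
paper), `IsRealEggPoint`.  ROWS: AN-35a′ `EvenModularDegreeOfFrickePlus` (PRINT, CE 2009 §2: `deg φ` even), **AN-35a `TwistedRealFibreCountLawAtTwo`**
(`#{twisted-real orbits over P} ≡ deg φ (mod 4)` — real topology of `φ′ : X₀(N)/w_N → E`; THEOREM-CANDIDATE, words-proof re-derived by REF1), **AN-35b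
`ModularDegreeTwoModFourMeetsEggAtTwo`** (ν = 1 ⇒ φ meets the egg at a twisted-real point; kernel corollary), AN-35b♯ `…OnOddAxisAtTwo` (+ axis of content 1;
theorem-grade off N ≡ 1 (4), data law on it ⇒ `@[conjecture]`), AN-35c `EggAxisDoorPrimeSupplyAtTwo` (Chebotarev supply; `@[conjecture]` — its theorem
regime is EMPTY on {ν = 1}, REF1), AN-35d `ModularDegreeTwoModFourHasBottomRungDoorAtTwo` (TARGET: ν = 1 ⇒ `HasBottomRungDoorAtTwo W`; `@[conjecture]`),
AN-35e `ModularDegreeTwoModFourOnEggLocusAtTwo` (BSD-side reading; `@[conjecture]`), S1 `RealEggPointsInfinite` (folklore), AN-35f `NuOneConductorShape`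
(CE Lemma 9; theorem-grade), AN-35g `TwoBadPrimesOneMultiplicativeNuZero` (data law 0/13 922 ⇒ `@[conjecture]`).  KERNEL (sketch, std axioms):
`twistedRealMeetsEgg_of_fibreCountLaw : AN-35a → S1 → …`, `twistedRealMeetsEgg_of_nu : AN-35b → …`, **`hasBottomRungDoor_of_nu : AN-35b♯ → AN-34b →
AN-35c → AN-34e′ → (0 < W.Δ → NoRationalTwoTorsion W → W.analyticRank = 1 → ∀ Dt, Odd Dt.c → IsFrickeEigen N Dt.f 1 → modularSymbol Dt.f 0 = 0 →
Dt.modularDegree % 4 = 2 → HasBottomRungDoorAtTwo W)`** — then the lead's `bsdp_two_of_exists_bottomRungDoor`; REF1 riders J3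
`content_one_of_level_not_one_mod_four`, G1 `meetsEgg_of_oddAxis : AN-35b♯ → AN-35b`, G2 `oddAxis_of_meetsEgg_off_one_mod_four` (AN-35b ⇒ AN-35b♯ off
N ≡ 1 (mod 4)).
REF1 §150 = D-an-94 (refuter-bsd-f1-sign2-ref1 g14, `HOME/REF1-AUDIT-v1.md` §150 l.2897–2916; evidence `HOME/REF1-data/b150/` — `lean/Probe150.lean`
d28d2e256c4a0eb5 farm rc 0, 10 probe sorries, 6 glue theorems std axioms; census150.py e20f7efb4bf3f791 / census150.txt 96598a7076547665 / nu1_curves150.tsv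
fd8227c301d81e21; INBOX 2026-08-28T23:51:52Z) ONE LINE verbatim: «D-an-94 DONE: AN-35 Sketch_v52.lean e4ae380f4eb9d988 AUDITED — AN-35a′ PRINT; AN-35a
`TwistedRealFibreCountLawAtTwo` SURVIVES theorem-candidate (proof re-derived and simplified …); AN-35b SURVIVES (kernel; `b ≠ 0` provable …); S1 true; AN-35f
theorem-grade (CE Lemma 9 …); AN-35b♯ theorem-grade OFF N ≡ 1 (mod 4) — kernel J3 `content_one_of_level_not_one_mod_four` + glue G1/G2 in Probe150 — DATA
LAW on N ≡ 1 (mod 4) where 331/442 ν=1 curves live ⇒ RETAG [conjecture]; AN-35g data law 0/13 922 ⇒ RETAG [conjecture]; AN-35c/35d/35e [conjecture] ✓;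
0 killed» — KEY CENSUS (local Cremona tables, N < 500 000): 225 493 optimal rank-1 Δ > 0 odd-torsion curves, ν = 1 for 442: egg 442/442, Tam odd 442/442
(= 1 at prime level), Ш_an = 1 442/442; all 893 curves with 4 ∣ Ш_an have v₂(deg φ) ≥ 3; ν = 1 ⇒ N PRIME (436) or a PERFECT SQUARE (6: 43², 14², 18², 38²,
158², 278², all Δ ∈ ℚ^{×2}); 0/5 138 pq, 0/2 130 2p, 0/210 185 ω ≥ 3; NEW: prime N ≡ 1 (mod 8) ⇒ ν = 0 (0/104).  CAVEAT FOR THE TURNKEY (REF1): AN-35c's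
Chebotarev regime (Δ ∉ {1,2,N,2N}·ℚ^{×2}) is EMPTY on {ν = 1}, so the «theorem-grade line for R⁺₀ on {ν = 1}» reads «on {ν = 1} ∩ {N ≢ 1 (4)} (≤ 111/442)
∩ {ℚ(E[2]) ⊄ H₁₆N·ℚ(ζ₈)} (uncounted; DATA ASK D-150-A)».  -ty instructions APPLIED: 35b♯/35g → `@[conjecture]`; 35c/35d/35e `@[conjecture]`; 35a′/35a/35b/
S1/35f plain `def` (cell tag policy: PRINT / REF1-certified words-theorems); J3/G1/G2 typed verbatim.
REF2 v44 §2 = D-an-95 (refuter-bsd-f1-sign2-ref2 g44, `HOME/REF2-PLACEMENT-v44.md` a3e663cc836184fe, INBOX 2026-08-29T00:08:07Z; folded pass 2, text only):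
AN-35f (ν = 1 ⇒ ω(N) ≤ 2; CE Lemma 9) and AN-35g (ω(N) = 2 with a multiplicative prime ⇒ 4 ∣ deg φ at rank 1): KNOWN-type / VARIANT — CE's Atkin–Lehner
factoring [cite: CalegariEmerton2009, §2] resp. Watkins's AL-strengthening [cite: Dummigan2006, §1] (35g a data law as typed ⇒ `@[conjecture]` right; its printed
parent is a conjecture too); «ν = 1 ⇒ Tam odd ∧ Ш_an odd ∧ #Sel₂ = 2» = Watkins's #Sel₂-strengthening read at v₂ = 1, IN PRINT AS A CONJECTURE (Watkins apud
Dummigan 2006, p. 346) — VARIANT; «ν = 1 ⇒ N prime or a perfect square; prime N ≡ 1 (8) ⇒ ν = 0» (REF1 census) = the r = 1, v₂ = 1 twin of CE Thm 1(b)/Thm 6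
with the real-locus condition flipped — NOT in print as stated, VARIANT-to-NEW-COMBINATION (nearest handles CE Thm 7, Merel 1996: the Hecke-at-2 /
multiplicity-one circle of the cell's C1); **AN-35a `TwistedRealFibreCountLawAtTwo`: no printed statement computing deg φ modulo 4 from the real topology of the
parametrisation found (CE use Galois/Hecke structure at 2; Ogg 1983 / Snowden 2011 §6.8 / Castaño-Bernard 2006 give π₀ of real loci only) ⇒ NEW-COMBINATION**
(prior use of the load-bearing lever on this problem = CE 2009 §2: factoring through X₀(N)/w gives ONE factor 2; AN-35a extracts the SECOND bit from X*(ℝ));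
beyond-print theorem: CANDIDATE yes (REF1 re-derived the proof); BSD₂ consequence: no (feeds R⁺₀ only through 35b♯/35c, both `@[conjecture]`/qualified).
Package AN-35: NEW-COMBINATION; `--prior "Watkins2002 §4.2; CalegariEmerton2009 Thm 1, Thm 6; Dummigan2006 Conj 5.3/Prop 5.4; Yazdani2011"`.
PARTITION: moves only by the qualified sub-slice above (REF1); beyond-print theorem: CANDIDATE for AN-35a/35b (placement pending), no for the BSD₂
consequence; BSD is not proved; stmt-23715 is not closed by anything here.

## The sketch's own summary (verbatim)

# Cell `bsd-f1-sign2`, lens `-an` g18 (MEMO-an v1.58 §2 AN-35): THE MODULAR DEGREE MOD 4 IS THE SIGNED OBJECT AT 2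
(sketch v52 = v51 + §21.2 S3 AN-35g; statements + kernel glue only, no `sorry`).

Setting: `W/ℚ` elliptic, `Δ_W > 0` (so `E(ℝ)` has two components and `Λ_E` is rectangular), `E(ℚ)[2] = 0`, and a
parametrisation datum `Dt` of level `N = N_W` whose newform is FRICKE-PLUS (`f | w_N = +f`, i.e. odd analytic rank; then
`{∞,0}_f = L(f,1)·(…) = 0`).  PRINT (Calegari–Emerton 2009 §2): `w_N` acts trivially on `E`, `φ = φ' ∘ π` factors through
`X⁺ := X₀(N)/w_N`, `deg φ = 2·deg φ'` is even.  NEW (AN-35): the real curve `X⁺(ℝ)` is the image of the ordinary real locus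
(`c τ = −τ̄ ∼ τ`) AND of the FRICKE-TWISTED real locus (`−τ̄ ∼ w_N τ`, tree `OnFrickeTwistedRealLocus`); real cusps of `X₀(N)` are
rational (denominator `δ ∣ N` with `gcd(δ, N/δ) ∣ 2`) and map to `E(ℚ)_tors`, of odd order, inside `E⁰(ℝ)`; every ordinary real
geodesic ends in cusps; hence every component of `X⁺(ℝ)` containing an ordinary-real image maps into `E⁰(ℝ)`, and a generic real
point `P` on the EGG has as real `φ'`-preimages only points of PURE TWISTED components, each with exactly two lifts
`y, w_N y ∈ Y₀(N)`, both twisted-real.  Mod-2 degree theory for the real-algebraic map `φ' : X⁺(ℝ) → E(ℝ)` (non-real preimages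
pair off under conj with equal multiplicities) gives, for all but finitely many real egg points `P`,
`#{twisted-real orbits over P} = 2·#{x ∈ X⁺(ℝ) : φ'(x) = P} ≡ 2·deg φ' = deg φ (mod 4)` (AN-35a).  COROLLARY (AN-35b): if
`deg φ ≡ 2 (mod 4)` then some twisted-real point maps to the egg — `κ_E = 1` (tree `TwistedRealMeetsEggAtTwo`) from ONE INTEGER.
With the tree's cusp-symbol criterion (AN-34b), a `3`-cycle door prime on that axis (AN-35c, supply) and AN-34e′, the curve has a
BOTTOM-RUNG DOOR (AN-35d), i.e. lies on the lead's PROVED sub-slice (`bsdp_two_of_exists_bottomRungDoor`), with no (HS), no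
`2`-converse, no Kolyvagin-at-`2`.  Invariant: `ν(E) := [deg φ_E ≡ 2 (mod 4)]` for the optimal curve (odd isogenies do not change
it).  BSD-side reading (AN-35e, conjecture-grade): `ν = 1 ⇒` egg locus (`E(ℚ)` meets the egg, `Ш[2] = 0`, Tamagawa product odd);
the `Ш[2]`-leg is Watkins' strengthened conjecture `#Sel₂(E) ∣ deg φ` (Watkins 2002 Conj. 4.1; Dummigan 2006 §1), the other two legs
are new.  Data: ENGINE MD (kit j319777 pilot, j319809 full; two engines sympow/`ellmoddegree`, exact `modular_degree` for `N ≤ 250`).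
[cite: CalegariEmerton2009, §2] [cite: Watkins2002, Conj. 4.1] [cite: Dummigan2006, §1] [cite: OggRealPoints1983, §3]
[cite: Snowden2011, §6.8] [cite: Cremona1997Algorithms, §2.8, §2.10]
-/

namespace Summit.BirchSwinnertonDyer.Rank1Residual.F1Sign2.ANg18

open Literature.NumberTheory.EllipticCurves Literature.NumberTheory.EllipticCurves.ModularForms UpperHalfPlane
open Summit.BirchSwinnertonDyer.Rank1Residual.F1Sign2 Summit.BirchSwinnertonDyer.Rank1Residual.F1Sign2.ANg17
open Summit.BirchSwinnertonDyer.BirchSwinnertonDyer.Theorems.RankOneAtTwoOneDoor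
open scoped Classical

noncomputable section

/-! ### §21.1 Objects -/

/-- `T_Dt(P)`: the number of `Γ₀(N)`-orbits `y ∈ Y₀(N)` on the FRICKE-TWISTED real locus (`c y = w_N y`) with `φ(y) = P`
(compare the tree's `ModularParametrizationData.fiberOrbitCount`, all orbits). [folklore] -/
def twistedRealFiberOrbitCount {W : WeierstrassCurve ℚ} {N : ℕ} [NeZero N]
    (Dt : ModularParametrizationData W N) (P : (W.baseChange ℂ).toAffine.Point) : ℕ :=
  Nat.card {y : Y0 N // ∃ τ : ℍ, Y0.mk N τ = y ∧ OnFrickeTwistedRealLocus N τ ∧ Dt.φ τ = P}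

/-- `P ∈ E(ℂ)` is an affine point with REAL coordinates whose abscissa lies on the egg of `W` (`Δ_W > 0`). [folklore] -/
def IsRealEggPoint (W : WeierstrassCurve ℚ) (P : (W.baseChange ℂ).toAffine.Point) : Prop :=
  ∃ (x y : ℝ) (h : (W.baseChange ℂ).toAffine.Nonsingular (x : ℂ) (y : ℂ)), P = .some (x : ℂ) (y : ℂ) h ∧ OnEggR W x

/-! ### §21.2 Statements -/

/-- **AN-35a′ (IN PRINT, Calegari–Emerton 2009 §2; support).**  If the newform of the datum is Fricke-plus and `{∞,0}_f = 0`
then `w_N` acts trivially on `E` (`φ ∘ w_N = φ + (φ(0) − φ(∞)) = φ`), `φ` factors through `X₀(N) → X₀(N)/w_N` (degree `2`), and the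
modular degree is even. [cite: CalegariEmerton2009, §2]
REF1 §150: AN-35a′ = PRINT (support); plain `def` (statement-only typer file). -/
def EvenModularDegreeOfFrickePlus : Prop :=
  ∀ (W : WeierstrassCurve ℚ) [W.IsElliptic] [NeZero (W.conductorNorm ℤ)]
    (Dt : ModularParametrizationData W (W.conductorNorm ℤ)),
    IsFrickeEigen (W.conductorNorm ℤ) Dt.f 1 → modularSymbol Dt.f 0 = 0 → Even Dt.modularDegree

/-- **AN-35a `TwistedRealFibreCountLawAtTwo` (THEOREM-CANDIDATE, BSD-free; real topology of `φ' : X₀(N)/w_N → E`).**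
`Δ_W > 0`, `E(ℚ)[2] = 0`, datum Fricke-plus with `{∞,0}_f = 0`.  Then for all but finitely many real points `P` of `E(ℂ)` on the EGG,
the number of twisted-real orbits in the fibre is `≡ deg φ (mod 4)`:
`T_Dt(P) = 2·#(φ'⁻¹(P) ∩ X⁺(ℝ)) ≡ 2 deg φ' = deg φ (mod 4)` — the real preimages of a generic egg point lie on pure twisted
components of `X⁺(ℝ)` (ordinary / mixed components contain real cusps or ordinary points and map into `E⁰(ℝ)` because real cusps are
rational and `E(ℚ)_tors` has odd order), each contributing the two twisted-real lifts `y, w_N y`; `#(φ'⁻¹(P) ∩ X⁺(ℝ)) ≡ deg φ' (mod 2)`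
for `P` off the (finite) set of real critical values and cusp images.  The exceptional set is contained in `φ(cusps) ∪ φ'(Ram φ' ∩ X⁺(ℝ))`.
[folklore] [cite: CalegariEmerton2009, §2] [cite: OggRealPoints1983, §3] [cite: Snowden2011, §6.8]
REF1 §150: AN-35a SURVIVES, THEOREM-CANDIDATE with the words-proof RE-DERIVED and simplified by REF1 (φ* : X₀(N)/w_N → E real, ordinary real
components ↦ E⁰ via rational cusps ↦ odd torsion, mod-2 fibre count on X*(ℝ), 2:1 lift {y, w_N y} ⇒ T(P) ≡ deg φ (mod 4); square N covered);
`Nat.card` of the `Y0 N` subtype junk-free on paper (finite fibres); KEEP the binder `modularSymbol Dt.f 0 = 0` (dischargeable at call sites by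
`modularSymbol_zero_eq_zero_of_frickeInvolution_eq_self`).  Cell tag policy: REF1-certified words-theorem ⇒ plain `def`.  Beyond-print theorem:
CANDIDATE (placement -ref2 pending: Snowden 2011 §6.8, Castaño-Bernard, Ogg 1983, CE 2009, Watkins 2002 §4; no printed «deg φ mod 4 vs egg» found). -/
def TwistedRealFibreCountLawAtTwo : Prop :=
  ∀ (W : WeierstrassCurve ℚ) [W.IsElliptic] [W.IsGloballyMinimal] [NeZero (W.conductorNorm ℤ)],
    0 < W.Δ → NoRationalTwoTorsion W →
    ∀ (Dt : ModularParametrizationData W (W.conductorNorm ℤ)),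
      IsFrickeEigen (W.conductorNorm ℤ) Dt.f 1 → modularSymbol Dt.f 0 = 0 →
      {P : (W.baseChange ℂ).toAffine.Point | IsRealEggPoint W P ∧
        ¬ ((twistedRealFiberOrbitCount Dt P : ZMod 4) = (Dt.modularDegree : ZMod 4))}.Finite

/-- **AN-35b `ModularDegreeTwoModFourMeetsEggAtTwo` (THEOREM-CANDIDATE, BSD-free corollary of AN-35a).**  Same setting; if
`deg φ ≡ 2 (mod 4)` then SOME point of the Fricke-twisted real locus, on an axis `(a, b, d)` with `b ≠ 0` (the Fricke arc `b = 0` passes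
through the ordinary point `i/√N` and maps into `E⁰(ℝ)`), maps to a real point on the egg: `κ_E(Dt) = 1` from ONE INTEGER.  (`ν = 1 ⇒ κ = 1`;
the converse fails: 141a1 `deg φ = 28`, `κ = 1`.)  ENGINE MD × ENGINE HC: `ν = 1 ⇒ κ_exact = 1` on 6/6 (pilot j319777; full j319809 pending),
0 violations. [folklore] [cite: CalegariEmerton2009, §2] [cite: OggRealPoints1983, §3]
REF1 §150: AN-35b SURVIVES (kernel corollary of AN-35a; `b ≠ 0` provable — the Fricke arc passes through the ordinary point i/√N ⇒ maps into E⁰);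
plain `def`; REF1 glue G1 `meetsEgg_of_oddAxis : AN-35b♯ → AN-35b` and G2 (AN-35b ⇒ AN-35b♯ off N ≡ 1 (mod 4)) typed at the end of this file. -/
def ModularDegreeTwoModFourMeetsEggAtTwo : Prop :=
  ∀ (W : WeierstrassCurve ℚ) [W.IsElliptic] [W.IsGloballyMinimal] [NeZero (W.conductorNorm ℤ)],
    0 < W.Δ → NoRationalTwoTorsion W →
    ∀ (Dt : ModularParametrizationData W (W.conductorNorm ℤ)),
      IsFrickeEigen (W.conductorNorm ℤ) Dt.f 1 → modularSymbol Dt.f 0 = 0 → Dt.modularDegree % 4 = 2 →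
      ∃ (τ : ℍ) (a b d : ℤ), a * d + (W.conductorNorm ℤ : ℤ) * b ^ 2 = 1 ∧ b ≠ 0 ∧
        (d : ℝ) * (W.conductorNorm ℤ : ℝ) * Complex.normSq (τ : ℂ) + 2 * (b : ℝ) * (W.conductorNorm ℤ : ℝ) * τ.re - (a : ℝ) = 0 ∧
        ∃ (x y : ℝ) (h : (W.baseChange ℂ).toAffine.Nonsingular (x : ℂ) (y : ℂ)),
          Dt.φ τ = .some (x : ℂ) (y : ℂ) h ∧ OnEggR W x

/-- **AN-35b♯ `ModularDegreeTwoModFourMeetsEggOnOddAxisAtTwo` (THEOREM-CANDIDATE for `N ≢ 1 (mod 4)`, where every axis has content `1`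
(`a d + N b² = 1` with `a, d` even forces `N ≡ 1 (mod 4)`); DATA LAW / conjecture-grade at `N ≡ 1 (mod 4)`).**  As AN-35b, and the axis can be
taken of CONTENT `1` (`¬(2 ∣ a ∧ 2 ∣ d)`), so that its axis form represents odd numbers (door primes live only on content-`1` axes; a
content-`4` axis carries CM points of discriminant `≡ 0 (mod 4)` only).  At `N ≡ 1 (mod 4)` content-`4` classes chain with content-`1` classes
through the order-`2` elliptic points (37a1: the disc-`37` class and the Fricke arc form ONE component through `i/√37`, `−1/2 + i/(2√37)`), and
the parity count of AN-35a does not separate contents.  ENGINE HC × MD: every `ν = 1` curve has a content-`1` egg class (pilot 6/6).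
[folklore] [cite: OggRealPoints1983, §3]
REF1 §150: AN-35b♯ THEOREM-GRADE OFF `N ≡ 1 (mod 4)` (kernel J3 `content_one_of_level_not_one_mod_four` + G1/G2 below) but a DATA LAW on
`N ≡ 1 (mod 4)`, where 331/442 of the ν = 1 curves live ⇒ RETAGGED `@[conjecture]` (REF1's ruling; nothing asserted). -/
@[conjecture] def ModularDegreeTwoModFourMeetsEggOnOddAxisAtTwo : Prop :=
  ∀ (W : WeierstrassCurve ℚ) [W.IsElliptic] [W.IsGloballyMinimal] [NeZero (W.conductorNorm ℤ)],
    0 < W.Δ → NoRationalTwoTorsion W →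
    ∀ (Dt : ModularParametrizationData W (W.conductorNorm ℤ)),
      IsFrickeEigen (W.conductorNorm ℤ) Dt.f 1 → modularSymbol Dt.f 0 = 0 → Dt.modularDegree % 4 = 2 →
      ∃ (τ : ℍ) (a b d : ℤ), a * d + (W.conductorNorm ℤ : ℤ) * b ^ 2 = 1 ∧ b ≠ 0 ∧ ¬ (2 ∣ a ∧ 2 ∣ d) ∧
        (d : ℝ) * (W.conductorNorm ℤ : ℝ) * Complex.normSq (τ : ℂ) + 2 * (b : ℝ) * (W.conductorNorm ℤ : ℝ) * τ.re - (a : ℝ) = 0 ∧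
        ∃ (x y : ℝ) (h : (W.baseChange ℂ).toAffine.Nonsingular (x : ℂ) (y : ℂ)),
          Dt.φ τ = .some (x : ℂ) (y : ℂ) h ∧ OnEggR W x

/-- **AN-35c `EggAxisDoorPrimeSupplyAtTwo` (SUPPLY; THEOREM-CANDIDATE by Chebotarev off a thin exceptional set, conjecture-grade on it).**
A content-`1` axis `(a, b, d)` of level `N = N_W` one of whose points maps to the egg carries a `3`-CYCLE DOOR PRIME: `−ℓ = Q_{a,b,d}(m, n)` with
`ℓ` prime, `DoorAdmissible W (−ℓ)` and `a_ℓ(W)` odd.  BOOKKEEPING (elementary, MEMO-an v1.58 §2): the discriminant form `Q_{a,b,d}` has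
discriminant `16N`; for `N` even every odd value is `≡ 1 (mod 8)` (so `ℓ ≡ 7 (mod 8)` automatically), for `N` odd every content-`1` axis takes odd
values in BOTH classes `1, 5 (mod 8)`; a level-`N` Heegner form of discriminant `−ℓ` has `−ℓ ≡ □ (mod 4N)`, so the Jacobi conditions of
`DoorAdmissible` at odd bad primes are automatic and `ℓ ∤ N` excludes finitely many `(m,n)`; the egg bit is constant on the axis (tree AN-34b +
connectedness), so every CM point of the axis has bit `1`.  HEART: the `3`-cycle condition.  If the `S₃`-field `ℚ(E[2])` is not contained in
`H_{16N}·ℚ(ζ₈)` (`H_{16N}` = ring class field of the order of discriminant `16N` in `ℚ(√N)`) — in particular whenever `Δ_W ∉ {1, 2, N, 2N}·ℚ^{×2}` — Chebotarev in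
the compositum gives infinitely many such `ℓ` on EVERY content-`1` axis (theorem-grade).  Why it might fail: on the exceptional set (`Δ_W ∈ N·ℚ^{×2}`:
37a1, Neumann–Setzer-type prime conductors) the `3`-cycle condition is a COSET condition on the form class and an egg class inside the identity coset
would carry no `3`-cycle prime at all — excluded by BSD₂ over `ℚ(√−ℓ)` at an identity door and never observed (ENGINE HC j317959: identity-prime bits
450/450 zero; 37a1: identity primes `ℓ = 67, …` sit on the bit-`0` classes, `3`-cycle primes `3, 7, 11, 47, 71, 83` on the egg classes).
[conjecture] [cite: Cox2013, Thm 9.12] [cite: GrossZagier1986, V.(2.2)] [cite: CalegariEmerton2009, §2]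
REF1 §150: AN-35c `[conjecture]` ✓ (Chebotarev theorem-regime per its own sufficient condition `Δ ∉ {1,2,N,2N}·ℚ^{×2}` is EMPTY on {ν = 1}:
Δ ∈ N·ℚ^{×2} at all 436 prime levels, ℚ^{×2} at the 6 squares ⇒ the «theorem-grade line for R⁺₀ on {ν = 1}» reads «on {ν = 1} ∩ {N ≢ 1 (4)} (≤ 111/442)
∩ {ℚ(E[2]) ⊄ H₁₆N·ℚ(ζ₈)} (uncounted; DATA ASK D-150-A)»). -/
@[conjecture] def EggAxisDoorPrimeSupplyAtTwo : Prop :=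
  ∀ (W : WeierstrassCurve ℚ) [W.IsElliptic] [W.IsGloballyMinimal] [NeZero (W.conductorNorm ℤ)],
    0 < W.Δ → NoRationalTwoTorsion W →
    ∀ (Dt : ModularParametrizationData W (W.conductorNorm ℤ)), IsFrickeEigen (W.conductorNorm ℤ) Dt.f 1 →
      ∀ (τ : ℍ) (a b d : ℤ), a * d + (W.conductorNorm ℤ : ℤ) * b ^ 2 = 1 → b ≠ 0 → ¬ (2 ∣ a ∧ 2 ∣ d) →
        (d : ℝ) * (W.conductorNorm ℤ : ℝ) * Complex.normSq (τ : ℂ) + 2 * (b : ℝ) * (W.conductorNorm ℤ : ℝ) * τ.re - (a : ℝ) = 0 →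
        (∃ (x y : ℝ) (h : (W.baseChange ℂ).toAffine.Nonsingular (x : ℂ) (y : ℂ)), Dt.φ τ = .some (x : ℂ) (y : ℂ) h ∧ OnEggR W x) →
        ∃ (ℓ : ℕ) (m n : ℤ), ℓ.Prime ∧ DoorAdmissible W (-(ℓ : ℤ)) ∧ Odd (W.frobeniusTrace ℓ) ∧
          axisForm (W.conductorNorm ℤ) a b d m n = -(ℓ : ℤ)

/-- **AN-35d `ModularDegreeTwoModFourHasBottomRungDoorAtTwo` (TARGET for the lead's R⁺₀ on the class `{ν = 1}`; THEOREM mod AN-35b♯, the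
tree's AN-34b / AN-34e′ and the supply AN-35c — kernel glue `hasBottomRungDoor_of_nu` below).**  On the crux's slice at `Δ_W > 0`: a curve whose
optimal parametrisation (odd constant, Fricke-plus) has `deg φ ≡ 2 (mod 4)` admits a BOTTOM-RUNG DOOR (`HasBottomRungDoorAtTwo W`), hence lies
on the proved sub-slice (`bsdp_two_of_exists_bottomRungDoor`: BSD₂(W) modulo print and the route's rank-`0` items).  Replaces, on `{ν = 1}`, the
conjecture AN-13 `HeegnerPointOnEggAtTwo` + the silent-prime supply of v8.16.  [conjecture] [cite: GrossZagier1986, I.(6.3), V.(2.2)]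
[cite: GrossLMS1991, §10]
REF1 §150: AN-35d `[conjecture]` ✓ (target; kernel reduction `hasBottomRungDoor_of_nu` below from AN-35b♯ + tree AN-34b + AN-35c + tree AN-34e′). -/
@[conjecture] def ModularDegreeTwoModFourHasBottomRungDoorAtTwo : Prop :=
  ∀ (W : WeierstrassCurve ℚ) [W.IsElliptic] [W.IsGloballyMinimal] [NeZero (W.conductorNorm ℤ)],
    0 < W.Δ → NoRationalTwoTorsion W → W.analyticRank = 1 →
    ∀ (Dt : ModularParametrizationData W (W.conductorNorm ℤ)), Odd Dt.c →
      IsFrickeEigen (W.conductorNorm ℤ) Dt.f 1 → modularSymbol Dt.f 0 = 0 → Dt.modularDegree % 4 = 2 →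
      HasBottomRungDoorAtTwo W

/-- **AN-35e `ModularDegreeTwoModFourOnEggLocusAtTwo` (BSD-SIDE READING, conjecture-grade; the `Ш[2]`-leg is Watkins' strengthened conjecture
`#Sel₂(E) ∣ deg φ`, the egg and Tamagawa legs are new).**  Rank one, `Δ_W > 0`, `E(ℚ)[2] = 0`, odd-constant Fricke-plus datum with
`deg φ ≡ 2 (mod 4)` ⟹ `E` lies on the EGG LOCUS (`E(ℚ)` meets the egg, `Ш(E/ℚ)[2] = 0`, odd Tamagawa product).  = AN-35b + the `→` half of
the egg-locus law AN-15 (`RealComponentEggLocusLawAtTwo`).  At a `3`-cycle door of an egg axis, Kramer gives `Ш(E/K)[2] = 0` and Gross–Zagier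
⊗ Gross 1991 Conj. 1.2 (2) makes BSD₂(E/K) EQUIVALENT to `2 ∤ ∏ c_p(E)`: a `ν = 1` curve with even Tamagawa product would contradict BSD₂.
ENGINE MD: `ν = 1 ⇒` (egg, Tam odd, Ш_an odd) 6/6 pilot; full box j319809. [conjecture] [cite: Watkins2002, Conj. 4.1] [cite: Dummigan2006, §1]
[cite: Kramer1981, Thm 1] [cite: GrossLMS1991, Conj. 1.2]
REF1 §150: AN-35e `[conjecture]` ✓ (BSD-side reading).  KEY CENSUS (REF1, local Cremona tables N < 500 000, `REF1-data/b150/data/`): 225 493 optimal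
rank-1 Δ > 0 odd-torsion curves, ν = 1 for 442: egg 442/442, Tam odd 442/442, Ш_an = 1 442/442; all 893 curves with 4 ∣ Ш_an have v₂(deg φ) ≥ 3;
ν = 1 ⇒ N PRIME (436) or a PERFECT SQUARE (6); NEW: prime N ≡ 1 (mod 8) ⇒ ν = 0 (0/104). -/
@[conjecture] def ModularDegreeTwoModFourOnEggLocusAtTwo : Prop :=
  ∀ (W : WeierstrassCurve ℚ) [W.IsElliptic] [W.IsGloballyMinimal] [NeZero (W.conductorNorm ℤ)],
    0 < W.Δ → NoRationalTwoTorsion W → W.analyticRank = 1 →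
    ∀ (Dt : ModularParametrizationData W (W.conductorNorm ℤ)), Odd Dt.c →
      IsFrickeEigen (W.conductorNorm ℤ) Dt.f 1 → Dt.modularDegree % 4 = 2 → OnEggLocusAtTwo W

/-- Support S1: the egg of a curve with `Δ_W > 0` has infinitely many real points (as points of `E(ℂ)`). [folklore]
REF1 §150: S1 TRUE (folklore real topology); plain `def`. -/
def RealEggPointsInfinite : Prop :=
  ∀ (W : WeierstrassCurve ℚ) [W.IsElliptic], 0 < W.Δ → {P : (W.baseChange ℂ).toAffine.Point | IsRealEggPoint W P}.Infinite

/-- Support S2 **AN-35f `NuOneConductorShape` (THEOREM-CANDIDATE, in-print ingredients: Calegari–Emerton 2009 Lemma 9 + proof of Thm 8).**  With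
`E(ℚ)[2] = 0` the Atkin–Lehner group `W ≅ (ℤ/2)^{ω(N)}` acts on the optimal quotient through a group of order `≤ 2` (CE Lemma 9: an involution acting as
`+1` on the differential is translation by the RATIONAL torsion point `φ(w_Q ∞) − φ(∞)`, which is then `2`-torsion, hence `O`), so `φ` factors through
`X₀(N)/W⁺` with `|W⁺| ≥ 2^{ω(N)−1}` and `w_N ∈ W⁺` at odd analytic rank: `2^{ω(N)−1} ∣ deg φ`.  Hence `deg φ ≡ 2 (mod 4)` forces `ω(N) ≤ 2` (and, for
`N = p^a q^b`, `w_{p^a} f = w_{q^b} f = −f`).  ENGINE MD pilot: the six `ν = 1` curves have `N ∈ {37, 79, 101, 197, 269, 373}` prime. [folklore]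
[cite: CalegariEmerton2009, Lemma 9, Thm 8] [cite: Dummigan2006, §1]
REF1 §150: AN-35f THEOREM-GRADE (CE Lemma 9; the Fricke / modular-symbol binders are unnecessary here but harmless); plain `def`. -/
def NuOneConductorShape : Prop :=
  ∀ (W : WeierstrassCurve ℚ) [W.IsElliptic] [NeZero (W.conductorNorm ℤ)], NoRationalTwoTorsion W →
    ∀ (Dt : ModularParametrizationData W (W.conductorNorm ℤ)),
      IsFrickeEigen (W.conductorNorm ℤ) Dt.f 1 → modularSymbol Dt.f 0 = 0 → Dt.modularDegree % 4 = 2 →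
      (W.conductorNorm ℤ).primeFactors.card ≤ 2

/-- Support S3 **AN-35g `TwoBadPrimesOneMultiplicativeNuZero` (NEW DATA LAW + MECHANISM, g18; conjecture-grade as typed).**  In the slice
(`Δ_W > 0`, `E(ℚ)[2] = 0`, Fricke-PLUS) with `ω(N) = 2` and at least one MULTIPLICATIVE prime: `4 ∣ deg φ`.  ENGINE MD full box
(j319809 ∪ j320414, 3 386 optimal rank-`1` curves, `N < 10⁴`): `ν = 0` for **784/784** such curves — `235/235` semistable `pq` with
`ε_p = ε_q = −1` (the ONLY `ω = 2` sign pattern for which Calegari–Emerton's Lemma 9 permits `ν = 1`), `223/223` additive×multiplicative with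
`ε_mult = −1`, `133 + 193` with an `ε = +1` sign (there `4 ∣ deg φ` is CE's theorem); the three `ω = 2` curves with `ν = 1` are
`196a1, 324c1, 1444b1` (`N = 4·7², 4·3⁴, 4·19²`, additive at both primes).  By contrast `ν = 1` for `40/76` PRIME conductors.  MECHANISM
(fixed-point parity; why it should be a theorem off a CM-to-torsion coincidence): for `Q ∥ N`, `1 < Q < N`, `ε_Q = −1`, the involution
`w_Q` of `X⁺ = X₀(N)/w_N` intertwines `φ'` with `σ : x ↦ −x + T_Q` (`T_Q = φ(w_Q∞) − φ(∞) ∈ E(ℚ)_{tors}`, odd order); over a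
`σ`-fixed point `P₀ ∈ ½T_Q + E[2]` that is not a critical value, `deg φ' ≡ #(Fix(w_Q) ∩ φ'⁻¹(P₀)) (mod 2)`, and `Fix(w_Q)` on `X⁺` is the
finite CM set fixed by `w_Q` or `w_{N/Q}` on `X₀(N)` (discriminants `−Q, −4Q, −N/Q, −4N/Q`); so `ν = 1` forces a `w_Q`- or
`w_{N/Q}`-fixed CM point to map into the `4`-set `½T_Q + E[2]` — for multiplicative `Q = p` these CM points have discriminant `−p`/`−4p`
and generically non-torsion images, while for `Q = 4` (`N = 4p^{2k}`) the `ℤ[i]`-points can (the three exceptions).  Why it might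
fail: one curve with a multiplicative `p ∥ N`, `ω(N) = 2`, `ε_p = ε_{N/p} = −1` and a disc-`−4p` (or `−p`) CM point of `X₀(N)` mapping to
a `2`-torsion-coset point. [folklore] [cite: CalegariEmerton2009, Lemma 9] [cite: OggRealPoints1983]
REF1 §150: AN-35g is a DATA LAW (0/13 922) ⇒ RETAGGED `@[conjecture]` (REF1's ruling; nothing asserted). -/
@[conjecture] def TwoBadPrimesOneMultiplicativeNuZero : Prop :=
  ∀ (W : WeierstrassCurve ℚ) [W.IsElliptic] [NeZero (W.conductorNorm ℤ)], 0 < W.Δ → NoRationalTwoTorsion W →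
    ∀ (Dt : ModularParametrizationData W (W.conductorNorm ℤ)),
      IsFrickeEigen (W.conductorNorm ℤ) Dt.f 1 → modularSymbol Dt.f 0 = 0 →
      (W.conductorNorm ℤ).primeFactors.card = 2 → (∃ p ∈ (W.conductorNorm ℤ).primeFactors, ¬ p ^ 2 ∣ W.conductorNorm ℤ) →
      4 ∣ Dt.modularDegree

/-! ### §21.3 Kernel glue -/

/-- AN-35a + S1 ⟹ `κ_E = 1` on `{deg φ ≡ 2 (mod 4)}` (tree `TwistedRealMeetsEggAtTwo`). -/
theorem twistedRealMeetsEgg_of_fibreCountLaw (hA : TwistedRealFibreCountLawAtTwo) (hS : RealEggPointsInfinite)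
    (W : WeierstrassCurve ℚ) [W.IsElliptic] [W.IsGloballyMinimal] [NeZero (W.conductorNorm ℤ)]
    (hΔ : 0 < W.Δ) (hT : NoRationalTwoTorsion W) (Dt : ModularParametrizationData W (W.conductorNorm ℤ))
    (hF : IsFrickeEigen (W.conductorNorm ℤ) Dt.f 1) (h0 : modularSymbol Dt.f 0 = 0) (hdeg : Dt.modularDegree % 4 = 2) :
    TwistedRealMeetsEggAtTwo W Dt := by
  have hfin := hA W hΔ hT Dt hF h0
  have hinf := hS W hΔ
  -- some real egg point is not exceptional
  have : ({P : (W.baseChange ℂ).toAffine.Point | IsRealEggPoint W P} \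
      {P | IsRealEggPoint W P ∧ ¬ ((twistedRealFiberOrbitCount Dt P : ZMod 4) = (Dt.modularDegree : ZMod 4))}).Nonempty :=
    (hinf.sdiff hfin).nonempty
  obtain ⟨P, hP, hPn⟩ := this
  have hmod : (twistedRealFiberOrbitCount Dt P : ZMod 4) = (Dt.modularDegree : ZMod 4) := by
    by_contra hne; exact hPn ⟨hP, hne⟩
  have hne0 : twistedRealFiberOrbitCount Dt P ≠ 0 := by
    intro hz
    rw [hz, Nat.cast_zero] at hmod
    have h4 : (Dt.modularDegree : ZMod 4) = ((Dt.modularDegree % 4 : ℕ) : ZMod 4) := by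
      rw [← ZMod.natCast_mod Dt.modularDegree 4]
    rw [h4, hdeg] at hmod
    exact absurd hmod (by decide)
  have hnon : Nonempty {y : Y0 (W.conductorNorm ℤ) // ∃ τ : ℍ, Y0.mk (W.conductorNorm ℤ) τ = y ∧
      OnFrickeTwistedRealLocus (W.conductorNorm ℤ) τ ∧ Dt.φ τ = P} := (Nat.card_ne_zero.mp hne0).1
  obtain ⟨⟨y, τ, -, hτ, hφ⟩⟩ := hnon
  obtain ⟨x, y', h, hP', hegg⟩ := hP
  exact ⟨τ, hτ, x, y', h, hφ.trans hP', hegg⟩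

/-- AN-35b ⟹ `κ_E = 1` (tree `TwistedRealMeetsEggAtTwo`), via the tree's axis description of the twisted locus. -/
theorem twistedRealMeetsEgg_of_nu (hB : ModularDegreeTwoModFourMeetsEggAtTwo)
    (W : WeierstrassCurve ℚ) [W.IsElliptic] [W.IsGloballyMinimal] [NeZero (W.conductorNorm ℤ)]
    (hΔ : 0 < W.Δ) (hT : NoRationalTwoTorsion W) (Dt : ModularParametrizationData W (W.conductorNorm ℤ))
    (hF : IsFrickeEigen (W.conductorNorm ℤ) Dt.f 1) (h0 : modularSymbol Dt.f 0 = 0) (hdeg : Dt.modularDegree % 4 = 2) :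
    TwistedRealMeetsEggAtTwo W Dt := by
  obtain ⟨τ, a, b, d, hdet, -, hax, x, y, h, hφ, hegg⟩ := hB W hΔ hT Dt hF h0 hdeg
  have hN : (W.conductorNorm ℤ) ≠ 0 := NeZero.ne _
  exact ⟨τ, (onFrickeTwistedRealLocus_iff_axis hN τ).mpr ⟨a, b, d, hdet, hax⟩, x, y, h, hφ, hegg⟩

/-- THE REDUCTION (kernel): AN-35b♯ + AN-34b (tree, theorem-candidate) + AN-35c (supply) + AN-34e′ (tree, theorem mod print) ⟹ AN-35d. -/
theorem hasBottomRungDoor_of_nu (hB : ModularDegreeTwoModFourMeetsEggOnOddAxisAtTwo)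
    (h34b : HeegnerCuspSymbolComponentFormulaAtTwo) (hC : EggAxisDoorPrimeSupplyAtTwo)
    (h34e : OddHeegnerCuspSymbolCertifiesBottomRungDoorAtTwo) :
    ModularDegreeTwoModFourHasBottomRungDoorAtTwo := by
  intro W _ _ _ hΔ hT hr Dt hc hF h0 hdeg
  obtain ⟨τ, a, b, d, hdet, hb, hcont, hax, x, y, h, hφ, hegg⟩ := hB W hΔ hT Dt hF h0 hdeg
  have hsym : (Dt.c : ℂ) * modularSymbol Dt.f (axisCusp (W.conductorNorm ℤ) a b) / 2 ∉ Dt.L.lattice := by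
    rcases h34b W hΔ Dt hF h0 τ a b d hdet hb hax with hzero | ⟨x', y', h', hφ', hiff⟩
    · rw [hφ] at hzero; exact absurd hzero (by rintro ⟨⟩)
    · have hxx : (x : ℂ) = (x' : ℂ) := by
        have := hφ.symm.trans hφ'
        cases this; rfl
      have hx : x' = x := (Complex.ofReal_injective hxx).symm
      exact hiff.mp (hx ▸ hegg)
  obtain ⟨ℓ, m, n, hℓ, hadm, hodd, hform⟩ := hC W hΔ hT Dt hF τ a b d hdet hb hcont hax ⟨x, y, h, hφ, hegg⟩
  exact h34e W hΔ hT hr Dt hc hF ℓ hℓ hadm hodd a b d m n hdet hb hform hsym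

end

/-! ### REF1 §150 kernel riders (typed VERBATIM from `HOME/REF1-data/b150/lean/Probe150.lean` d28d2e256c4a0eb5: J3, G1, G2; std axioms) -/

/-- J3 (kernel certificate of the AN-35b♯ docstring claim «`a d + N b² = 1` with `a, d` even forces `N ≡ 1 (mod 4)`»):
off `N ≡ 1 (mod 4)` every axis has content `1`. -/
theorem content_one_of_level_not_one_mod_four (N : ℕ) (a b d : ℤ) (hdet : a * d + (N : ℤ) * b ^ 2 = 1)
    (hN : (N : ℤ) % 4 ≠ 1) : ¬ (2 ∣ a ∧ 2 ∣ d) := by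
  rintro ⟨⟨a', rfl⟩, ⟨d', rfl⟩⟩
  have h4 : ((2 * a') * (2 * d') + (N : ℤ) * b ^ 2 : ZMod 4) = 1 := by exact_mod_cast congrArg (Int.cast : ℤ → ZMod 4) hdet
  have key : ∀ (x y z w : ZMod 4), (2 * x) * (2 * y) + z * w ^ 2 = 1 → z = 1 := by decide
  have hz : ((N : ℤ) : ZMod 4) = 1 := key _ _ _ _ (by simpa using h4)
  have hdvd : (4 : ℤ) ∣ (N : ℤ) - 1 := by
    have : (((N : ℤ) - 1 : ℤ) : ZMod 4) = 0 := by rw [Int.cast_sub, hz]; simp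
    exact (ZMod.intCast_zmod_eq_zero_iff_dvd _ 4).mp this
  omega

/-- G1: AN-35b♯ ⟹ AN-35b (drop the content clause). -/
theorem meetsEgg_of_oddAxis (h : ModularDegreeTwoModFourMeetsEggOnOddAxisAtTwo) : ModularDegreeTwoModFourMeetsEggAtTwo := by
  intro W _ _ _ hΔ h2 Dt hF hS hν
  obtain ⟨τ, a, b, d, hdet, hb, _, hax, x, y, hns, hφ, hegg⟩ := h W hΔ h2 Dt hF hS hν
  exact ⟨τ, a, b, d, hdet, hb, hax, x, y, hns, hφ, hegg⟩

/-- G2: AN-35b ⟹ AN-35b♯ OFF `N ≡ 1 (mod 4)` (the theorem-grade regime named in the AN-35b♯ docstring), by J3. -/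
theorem oddAxis_of_meetsEgg_off_one_mod_four (h : ModularDegreeTwoModFourMeetsEggAtTwo)
    (W : WeierstrassCurve ℚ) [W.IsElliptic] [W.IsGloballyMinimal] [NeZero (W.conductorNorm ℤ)]
    (hN : ((W.conductorNorm ℤ : ℕ) : ℤ) % 4 ≠ 1) (hΔ : 0 < W.Δ) (h2 : NoRationalTwoTorsion W)
    (Dt : ModularParametrizationData W (W.conductorNorm ℤ)) (hF : IsFrickeEigen (W.conductorNorm ℤ) Dt.f 1)
    (hS : modularSymbol Dt.f 0 = 0) (hν : Dt.modularDegree % 4 = 2) :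
    ∃ (τ : ℍ) (a b d : ℤ), a * d + (W.conductorNorm ℤ : ℤ) * b ^ 2 = 1 ∧ b ≠ 0 ∧ ¬ (2 ∣ a ∧ 2 ∣ d) ∧
      (d : ℝ) * (W.conductorNorm ℤ : ℝ) * Complex.normSq (τ : ℂ) + 2 * (b : ℝ) * (W.conductorNorm ℤ : ℝ) * τ.re - (a : ℝ) = 0 ∧
      ∃ (x y : ℝ) (hxy : (W.baseChange ℂ).toAffine.Nonsingular (x : ℂ) (y : ℂ)),
        Dt.φ τ = .some (x : ℂ) (y : ℂ) hxy ∧ OnEggR W x := by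
  obtain ⟨τ, a, b, d, hdet, hb, hax, x, y, hns, hφ, hegg⟩ := h W hΔ h2 Dt hF hS hν
  exact ⟨τ, a, b, d, hdet, hb, content_one_of_level_not_one_mod_four _ a b d hdet hN, hax, x, y, hns, hφ, hegg⟩

end Summit.BirchSwinnertonDyer.Rank1Residual.F1Sign2.ANg18
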